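import Summits.CriticalPhenomena.PercolationContinuityZ3.Theorems.PercNearOneGluingNoHeavyRsw3InvasionBackboneExists
import HarnessLib

/-!
# RSW3 lane (P2, gen 29): INVASION PERCOLATION XL — THE LABELS ALONG THE BACKBONE: `limsup = p_c` exactly
# (labels `> p_c` infinitely often — at every outlet — yet eventually `≤ y` for every `y > p_c`; every graph given the label asymptotics; a.s. on `ℤ^d`, `d ≥ 2`, p205010)

builds on p205010 (kernel theorem, internal audit signed; external expert review pending) — used only in the `ℤ^d` statement (through file XXX).

Cell `prim-rsw3`, prover seat `prim-rsw3-p2` (gen 29), memo `run/shared/lean/prim/rsw3/P2-RSWLITE.md` §36.  Support file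
(`--supports stmt-CriticalPhenomena-4575`); no definitions, no named facts, no sorries.

Lyons–Peres–Schramm 2006, proof of Thm. 3.12: "It also follows that the limsup of the labels `U` along that end is equal to `p_c`."  Kernel version for a self-avoiding
ray `R` of the invasion tree from the root (the backbone): the bond `s(R i, R (i+1))` is absorbed at a time `n_i → ∞` (distinct bonds, one bond per step), so its label is
eventually `≤ y` for every `y > p` as soon as the accepted labels are (`eventually_label_ray_le`); and the ray crosses every outlet bond, whose label is `> p`
(`frequently_lt_label_ray`).  On `ℤ^d` (`d ≥ 2`): a.s. along the backbone the labels exceed `p_c` infinitely often and are eventually below every `y > p_c`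
(`ae_backbone_labels`): `limsup_i U(s(R i, R (i+1))) = p_c(ℤ^d)`.

References: R. Lyons, Y. Peres, O. Schramm, Ann. Probab. 34 (2006), Thm. 3.12 (proof) [LyonsPeresSchramm2006].
-/

noncomputable section

namespace Summit.CriticalPhenomena.PercolationContinuityZ3.Theorems.Rsw3

open Finset Filter MeasureTheory Literature.Probability.LatticeModels Literature.Probability.Percolation Literature.Probability.Percolation.Invasion

section General

variable {V : Type*} [DecidableEq V] {G : SimpleGraph V} [G.LocallyFinite]

/-- **Labels along a tree ray are eventually small**: if the accepted labels are eventually `≤ y`, so are the labels of the bonds of any self-avoiding ray of the invasion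
tree (each bond of the ray is absorbed at its own time, and these times tend to infinity). [cite: LyonsPeresSchramm2006, Thm. 3.12 (proof: "the limsup of the labels along that end")] -/
theorem eventually_label_ray_le {U : Sym2 V → ℝ} {o : V} {y : ℝ} (hev : ∀ᶠ n in atTop, acceptedLabel G U o n ≤ y)
    {R : ℕ → V} (hR : Function.Injective R) (hRadj : ∀ i, (tree G U o).Adj (R i) (R (i + 1))) :
    ∀ᶠ i in atTop, U s(R i, R (i + 1)) ≤ y := by
  classical
  -- the absorption time of the `i`-th bond of the ray
  have hex : ∀ i, ∃ n, ∃ a : V × V, newDart G U (invasion G U o n) = some a ∧ s(a.1, a.2) = s(R i, R (i + 1)) :=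
    fun i => (mem_treeEdges G).1 ((tree_adj G).1 (hRadj i)).1
  choose n a ha hae using hex
  have hninj : Function.Injective n := by
    intro i i' h
    have hee : s((a i).1, (a i).2) = s((a i').1, (a i').2) := by
      have h1 := ha i
      have h2 := ha i'
      rw [h] at h1
      rw [newDart_some_inj h1 h2]
    have : s(R i, R (i + 1)) = s(R i', R (i' + 1)) := by rw [← hae i, ← hae i', hee]
    rcases Sym2.eq_iff.1 this with ⟨h1, -⟩ | ⟨h1, h2⟩
    · exact hR h1
    · have := hR h1; have := hR h2; omega
  have hlabel : ∀ i, U s(R i, R (i + 1)) = acceptedLabel G U o (n i) := fun i => by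
    rw [acceptedLabel_of_eq_some G (ha i), hae i]
  obtain ⟨N₀, hN₀⟩ := eventually_atTop.1 hev
  -- only finitely many bonds of the ray are absorbed before `N₀`
  have hfin : {i : ℕ | n i < N₀}.Finite := ((Set.finite_Iio N₀).preimage hninj.injOn)
  obtain ⟨I, hI⟩ := hfin.bddAbove
  refine eventually_atTop.2 ⟨I + 1, fun i hi => ?_⟩
  rw [hlabel i]
  refine hN₀ _ (not_lt.1 fun hlt => ?_)
  have := hI hlt
  omega

/-- **Labels along a ray from the root exceed `p` infinitely often** (outlets beyond every time, each with label `> p`; the ray crosses every outlet bond).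
[cite: LyonsPeresSchramm2006, Thm. 3.12 (proof)] -/
theorem frequently_lt_label_ray [Infinite V] (hG : G.Preconnected) {U : Sym2 V → ℝ} {o : V} {p : ℝ}
    (hout : ∀ k, ∃ m, k ≤ m ∧ IsOutlet G U o m ∧ p < acceptedLabel G U o m)
    {R : ℕ → V} (hR : Function.Injective R) (hR0 : R 0 = o) (hRadj : ∀ i, (tree G U o).Adj (R i) (R (i + 1))) :
    ∃ᶠ i in atTop, p < U s(R i, R (i + 1)) := by
  refine frequently_atTop.2 fun N => ?_
  obtain ⟨m, i, a, hm, hNi, ha, -, h1, h2⟩ :=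
    exists_outlet_crossing_ge hG (fun k => (hout k).imp fun m hm => ⟨hm.1, hm.2.1⟩) hR hR0 hRadj N
  -- the outlet `m` found has label `> p`: every outlet does, since later outlets with label `> p` exist and labels decrease
  obtain ⟨m', hmm', hm', hp'⟩ := hout (m + 1)
  have hp : p < acceptedLabel G U o m := hp'.trans (hm m' (Nat.lt_of_succ_le hmm'))
  refine ⟨i, hNi, ?_⟩
  rw [h1, h2, ← acceptedLabel_of_eq_some G ha]
  exact hp

end General

/-! ## `ℤ^d` -/

variable {d : ℕ}

/-- **THE LABELS ALONG THE BACKBONE OF THE INVASION OF `ℤ^d` HAVE `limsup` EXACTLY `p_c(ℤ^d)`** (`d ≥ 2`, p205010): almost surely, for every self-avoiding ray `R` of the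
invasion tree from the origin (there is exactly one, file XXXVI), the bond labels `U(s(R i, R (i+1)))` exceed `p_c` for infinitely many `i` and are eventually `≤ y` for
every `y > p_c`. [cite: LyonsPeresSchramm2006, Thm. 3.12 (proof: "the limsup of the labels U along that end is equal to p_c")] -/
theorem ae_backbone_labels (hd : 2 ≤ d) :
    ∀ᵐ U ∂(labelMeasure (Site d)), ∀ R : ℕ → Site d, Function.Injective R → R 0 = 0 → (∀ i, (tree (zdGraph d) U 0).Adj (R i) (R (i + 1))) →
      (∃ᶠ i in atTop, criticalProb (zdGraph d) (0 : Site d) < U s(R i, R (i + 1))) ∧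
      ∀ y : ℝ, criticalProb (zdGraph d) (0 : Site d) < y → ∀ᶠ i in atTop, U s(R i, R (i + 1)) ≤ y := by
  haveI : Nonempty (Fin d) := ⟨⟨0, by omega⟩⟩
  haveI : Infinite (Site d) := Pi.infinite_of_right
  filter_upwards [ae_forall_exists_isOutlet hd, ae_forall_eventually_acceptedLabel_le hd] with U hout hev
  intro R hR hR0 hRadj
  exact ⟨frequently_lt_label_ray zdGraph_preconnected_holds hout hR hR0 hRadj, fun y hy => eventually_label_ray_le (hev y hy) hR hRadj⟩

end Summit.CriticalPhenomena.PercolationContinuityZ3.Theorems.Rsw3
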